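import Literature.MathematicalPhysics.QuantumManyBody.BoseGasHardCoreContact
import Literature.MathematicalPhysics.QuantumManyBody.BoseGasBoundaryConditionIndependence

/-!
# Hard-core Bose gases at the critical density: blow-up of the energy per particle and
# boundary-condition independence at every density

Topic `Literature/MathematicalPhysics/QuantumManyBody`, over the carriers of
`BoseEinsteinCondensation.lean` / `BoseGasThermodynamicLimit.lean` (Dirichlet trial states,
`groundStateEnergy v N L = E₀^D(N,L)`, `energyPerParticleDirichlet/Periodic`, `sideLength`),
`BoseGasThermodynamicLimitRuelle.lean` (`infEnergy`, `infEnergy_union_le`, the envelope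
`limsupEnergyPerParticle v ρ = e⁺(ρ)`, `criticalDensity v = ρ_c(v)`, `hardCorePotential`),
`BoseGasBoundaryConditionIndependence.lean` (the corrected fact
`LSSY2005_e0_periodic_eq_dirichlet_offCritical` and the blow-up case
`tendsto_energyPerParticlePeriodic_of_iSup_limsup_eq_top`) and `BoseGasHardCoreContact.lean`
(few nearly-touching pairs at finite energy, `sum_lintegral_shellPair_le`).

Context. The vendored facts `LSSY2005_e0_dirichlet_exists` / `LSSY2005_e0_periodic_eq_dirichlet`
(LSSY 2005, Ch. 2, (2.2): "These [boundary conditions] should not matter for the thermodynamic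
limit") quantify over every density `ρ > 0`, including the critical (close-packing) density
`ρ_c(v)` of a potential with a hard core, where their conclusions were left open by the corrected
off-critical facts (`…_offCritical`, discharged) and reduced to the question whether the energy per
particle blows up on approach to `ρ_c` (`…_iff_atCritical_of_iSup_lt_top`). This file settles that
question for **hard-core potentials** — `v = +∞` on `r < a` (LSSY Ch. 2, paragraph after (2.1):
"the hard core potential `v(r) = ∞` if `r < a` and `v(r) = 0` otherwise"), with a tail bounded by
some `V < ∞` on `[a, ∞)` and finite range `R₀` — i.e. for every potential of LSSY's standing class
that has a genuine hard core and is bounded outside it: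

* `iSup_limsupEnergyPerParticle_eq_top_of_hardCore` — **blow-up at the critical density**: for
  `ρ ≥ ρ_c(v)`, `sup_{0<ρ'<ρ} e⁺(ρ') = +∞`;
* `hardCore_e0_dirichlet_exists`, `hardCore_e0_periodic_eq_dirichlet` — hence the conclusions of
  BOTH vendored facts hold for such potentials at EVERY density `ρ > 0` (limit `e⁺(ρ) < ∞` below
  `ρ_c`, `+∞` at and above, for Dirichlet and periodic boxes alike);
  `tendsto_energyPerParticle_hardCorePotential` specialises to the hard-sphere gas
  `hardCorePotential a`.

Proof: the free-volume ("remove the tight particles and compress") argument, which we have not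
found in print for these carriers and tag folklore. Suppose `e⁺ ≤ G < ∞` on `(0, ρ_c)`. Fix a
small `δ` (`δ ≤ a/20`, `2304 a (G+1) δ ≤ 1`) and `ρ' < ρ_c` close to `ρ_c`. A near-minimiser `ψ`
of `E₀^D(N, L_N(ρ'))` has `∫|∇ψ|² ≤ (G+1)N`, so by `BoseGasHardCoreContact` the expected number of
ordered pairs with `a < |xᵢ - xⱼ| < a + δ` is `≤ 576 δ² (G+1) N =: εN`, and (Markov,
`exists_ne_zero_tightPairCount_le`) `ψ` does not vanish at some configuration `X₀` with at most
`εN + 1` tight particles; at `X₀` all particles are in the box and pairwise `> a` apart. Discard the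
tight particles: `M ≥ (1-ε)N - 1` particles pairwise `≥ a + δ` apart remain. Scale by
`μ = (a + δ/2)/(a + δ)` and translate by `δ` in every coordinate: the points are pairwise
`≥ a + δ/2` apart and carry disjoint cubes of side `δ/8`, pairwise at distance `> a`, inside the
box of side `μ L_N + 2δ`. The energy for `v` is at most the hard-sphere energy plus
`V M (2(R₀+a)/a + 1)³` (`infEnergy_le_infEnergy_hardCorePotential_add`: where the hard-sphere
energy is finite the particles are pairwise `> a` apart and each has at most `(2(R₀+a)/a+1)³`
partners within range, `card_filter_dist_lt_le_pow`), and by subadditivity of the hard-sphere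
energy over regions more than `a` apart (`infEnergy_biUnion_le_of_separated`, from Ruelle's
`infEnergy_union_le`) `E₀^D(M, μL_N + 2δ) ≤ M (E₀^{D,hc}(1, δ/8) + V (2(R₀+a)/a+1)³)`. Since
`(1-ε) μ⁻³ > 1 + δ/(4a)`, the box of side `μ L_N + 2δ` fits into the box of `M` particles at
density `ρ'' = ρ'(1 + δ/(4a))` for all large `M` (`exists_forall_box_fit`, convexity of the cube),
whence `e⁺(ρ'') < ∞` (`limsupEnergyPerParticle_lt_top_of_compression`) at a density `ρ'' > ρ_c` —
contradicting the definition of `ρ_c`. The conclusions at `ρ_c` then follow from the blow-up case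
of `BoseGasBoundaryConditionIndependence.lean`, below/above `ρ_c` from the off-critical facts.

References: E. H. Lieb, R. Seiringer, J. P. Solovej, J. Yngvason, *The Mathematics of the Bose Gas
and its Condensation* (2005) [LSSY2005], Ch. 2; D. Ruelle, *Statistical Mechanics: Rigorous
Results* (1969) [Ruelle1969], §3.3.12 (close-packing density "entirely due to" hard cores) and
§3.5.11 (thermodynamic limit of the ground-state energy).

Deliberately NOT here: tails that are unbounded near contact or `+∞` on further sets of distances
beyond the core (the residual class of `LSSY2005_e0_periodic_eq_dirichlet_iff_atCritical_of_iSup_lt_top`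
for general measurable `v`); potentials without a hard core; the value of `ρ_c` (Kepler).
-/

noncomputable section

open MeasureTheory Filter Topology Set Function
open scoped ENNReal NNReal

namespace Literature.MathematicalPhysics.QuantumManyBody.BoseGas

/-! ### The Markov step: a configuration in the support with few tight particles -/

section Markov

variable {N : ℕ} {a δ : ℝ} {v : ℝ → ℝ≥0∞}

/-- The number of ordered nearly-touching pairs `(i, j)`, `a < |x_i - x_j| < a + δ`, of the
configuration `X` (as an extended real). [folklore] -/
def tightPairCount (a δ : ℝ) (X : Config N) : ℝ≥0∞ :=
  ∑ i : Fin N, ∑ j ∈ Finset.univ.erase i, (shellPair a δ i j).indicator (fun _ => (1 : ℝ≥0∞)) X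

open Classical in
/-- The set of **tight particles**: those with a partner at distance in `(a, a + δ)`. [folklore] -/
def tightSet (a δ : ℝ) (X : Config N) : Finset (Fin N) :=
  Finset.univ.filter fun i => ∃ j ∈ Finset.univ.erase i, X ∈ shellPair a δ i j

/-- Each tight particle accounts for at least one ordered tight pair. [folklore] -/
theorem card_tightSet_le (a δ : ℝ) (X : Config N) :
    ((tightSet a δ X).card : ℝ≥0∞) ≤ tightPairCount a δ X := by
  classical
  rw [tightPairCount, Finset.card_eq_sum_ones, Nat.cast_sum]
  simp only [Nat.cast_one]
  calc ∑ _i ∈ tightSet a δ X, (1 : ℝ≥0∞)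
      ≤ ∑ i ∈ tightSet a δ X, ∑ j ∈ Finset.univ.erase i,
          (shellPair a δ i j).indicator (fun _ => (1 : ℝ≥0∞)) X := by
        refine Finset.sum_le_sum fun i hi => ?_
        simp only [tightSet, Finset.mem_filter, Finset.mem_univ, true_and] at hi
        obtain ⟨j, hj, hX⟩ := hi
        calc (1 : ℝ≥0∞) = (shellPair a δ i j).indicator (fun _ => (1 : ℝ≥0∞)) X :=
              (indicator_of_mem hX (fun _ => (1 : ℝ≥0∞))).symm
          _ ≤ ∑ j ∈ Finset.univ.erase i, (shellPair a δ i j).indicator (fun _ => (1 : ℝ≥0∞)) X :=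
              Finset.single_le_sum (f := fun j => (shellPair a δ i j).indicator
                (fun _ => (1 : ℝ≥0∞)) X) (fun _ _ => zero_le) hj
    _ ≤ tightPairCount a δ X :=
        Finset.sum_le_sum_of_subset_of_nonneg (Finset.subset_univ _) fun _ _ _ => zero_le

/-- A particle that is not tight and does not overlap is at distance `≥ a + δ` from every other
particle. [folklore] -/
theorem le_dist_of_not_mem_tightSet {X : Config N} {i : Fin N} (hi : i ∉ tightSet a δ X)
    {j : Fin N} (hji : j ≠ i) (hgt : a < dist (X i) (X j)) : a + δ ≤ dist (X i) (X j) := by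
  by_contra hlt
  have hlt' : dist (X i) (X j) < a + δ := not_le.1 hlt
  apply hi
  simp only [tightSet, Finset.mem_filter, Finset.mem_univ, true_and]
  exact ⟨j, Finset.mem_erase.2 ⟨hji, Finset.mem_univ _⟩, hgt, hlt'⟩

/-- The expected number of ordered tight pairs is at most `576 δ²` times the kinetic energy.
[folklore] -/
theorem lintegral_tightPairCount_mul_le (ha : 0 < a) (hδ : 0 < δ) (hδa : 20 * δ ≤ a)
    (hcore : ∀ r, r < a → v r = ⊤) {ψ : Config N → ℂ} (hψ : ContDiff ℝ 1 ψ)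
    (hE : rawEnergy v ψ ≠ ⊤) :
    ∫⁻ X, tightPairCount a δ X * (‖ψ X‖₊ : ℝ≥0∞) ^ 2 ≤
      ENNReal.ofReal (576 * δ ^ 2) * ∫⁻ X, kineticDensity ψ X := by
  have hf : Measurable fun X => (‖ψ X‖₊ : ℝ≥0∞) ^ 2 := measurable_ennnormSq hψ.continuous
  have hm : ∀ i j, Measurable fun X => (shellPair a δ i j).indicator
      (fun X => (‖ψ X‖₊ : ℝ≥0∞) ^ 2) X := fun i j => hf.indicator (measurableSet_shellPair a δ i j)
  have hpt : ∀ X, tightPairCount a δ X * (‖ψ X‖₊ : ℝ≥0∞) ^ 2 = ∑ i : Fin N,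
      ∑ j ∈ Finset.univ.erase i, (shellPair a δ i j).indicator (fun X => (‖ψ X‖₊ : ℝ≥0∞) ^ 2) X := by
    intro X
    rw [tightPairCount, Finset.sum_mul]
    refine Finset.sum_congr rfl fun i _ => ?_
    rw [Finset.sum_mul]
    refine Finset.sum_congr rfl fun j _ => ?_
    by_cases hX : X ∈ shellPair a δ i j <;> simp [hX]
  calc ∫⁻ X, tightPairCount a δ X * (‖ψ X‖₊ : ℝ≥0∞) ^ 2
      = ∫⁻ X, ∑ i : Fin N, ∑ j ∈ Finset.univ.erase i,
          (shellPair a δ i j).indicator (fun X => (‖ψ X‖₊ : ℝ≥0∞) ^ 2) X := lintegral_congr hpt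
    _ = ∑ i : Fin N, ∑ j ∈ Finset.univ.erase i,
          ∫⁻ X, (shellPair a δ i j).indicator (fun X => (‖ψ X‖₊ : ℝ≥0∞) ^ 2) X := by
        rw [lintegral_finsetSum _ fun i _ =>
          show Measurable (fun X => ∑ j ∈ Finset.univ.erase i,
            (shellPair a δ i j).indicator (fun X => (‖ψ X‖₊ : ℝ≥0∞) ^ 2) X) from
            Finset.measurable_sum _ fun j _ => hm i j]
        exact Finset.sum_congr rfl fun i _ => lintegral_finsetSum _ fun j _ => hm i j
    _ ≤ ENNReal.ofReal (576 * δ ^ 2) * ∫⁻ X, kineticDensity ψ X :=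
        sum_lintegral_shellPair_le ha hδ hδa hcore hψ hE

/-- **The Markov step.** A normalised finite-energy `C¹` wave function for a hard core of diameter
`a` does not vanish at some configuration with at most `576 δ² ∫|∇ψ|² + 1` ordered tight pairs.
[folklore] -/
theorem exists_ne_zero_tightPairCount_le (ha : 0 < a) (hδ : 0 < δ) (hδa : 20 * δ ≤ a)
    (hcore : ∀ r, r < a → v r = ⊤) {ψ : Config N → ℂ} (hψ : ContDiff ℝ 1 ψ)
    (hE : rawEnergy v ψ ≠ ⊤) (hnorm : ∫⁻ X, (‖ψ X‖₊ : ℝ≥0∞) ^ 2 = 1) :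
    ∃ X : Config N, ψ X ≠ 0 ∧
      tightPairCount a δ X ≤ ENNReal.ofReal (576 * δ ^ 2) * (∫⁻ X, kineticDensity ψ X) + 1 := by
  set B : ℝ≥0∞ := ENNReal.ofReal (576 * δ ^ 2) * ∫⁻ X, kineticDensity ψ X with hB
  have hKE : ∫⁻ X, kineticDensity ψ X ≤ rawEnergy v ψ := lintegral_mono fun X => le_self_add
  have hBtop : B ≠ ⊤ := ENNReal.mul_ne_top ENNReal.ofReal_ne_top (ne_top_of_le_ne_top hE hKE)
  by_contra h
  simp only [not_exists, not_and, not_le] at h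
  have hpt : ∀ X, (B + 1) * (‖ψ X‖₊ : ℝ≥0∞) ^ 2 ≤ tightPairCount a δ X * (‖ψ X‖₊ : ℝ≥0∞) ^ 2 := by
    intro X
    by_cases hX : ψ X = 0
    · simp [hX]
    · exact mul_le_mul' (h X hX).le le_rfl
  have hle : B + 1 ≤ B :=
    calc B + 1 = (B + 1) * ∫⁻ X, (‖ψ X‖₊ : ℝ≥0∞) ^ 2 := by rw [hnorm, mul_one]
      _ = ∫⁻ X, (B + 1) * (‖ψ X‖₊ : ℝ≥0∞) ^ 2 :=
          (lintegral_const_mul _ (measurable_ennnormSq hψ.continuous)).symm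
      _ ≤ ∫⁻ X, tightPairCount a δ X * (‖ψ X‖₊ : ℝ≥0∞) ^ 2 := lintegral_mono hpt
      _ ≤ B := lintegral_tightPairCount_mul_le ha hδ hδa hcore hψ hE
  exact absurd hle (not_le.2 (ENNReal.lt_add_right hBtop one_ne_zero))

end Markov

/-! ### Separated families of regions and cubes -/

section Separated

variable {v : ℝ → ℝ≥0∞} {R : ℝ}

/-- **Subadditivity over a separated family**: `E(∑ n_c, ⋃ U_c) ≤ ∑ E(n_c, U_c)` when the
regions are pairwise at distance `> R ≥ range(v)` (Finset induction on `infEnergy_union_le`).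
[cite: Ruelle1969, §3.5.11] -/
theorem infEnergy_biUnion_le_of_separated (hv : Measurable v) (hv0 : ∀ r, R < r → v r = 0)
    (hR : 0 ≤ R) {ι : Type*} [DecidableEq ι] (T : Finset ι) (U : ι → Set Space)
    (hsep : ∀ c ∈ T, ∀ c' ∈ T, c ≠ c' → ∀ x ∈ U c, ∀ y ∈ U c', R < dist x y) (n : ι → ℕ) :
    infEnergy v (∑ c ∈ T, n c) (⋃ c ∈ T, U c) ≤ ∑ c ∈ T, infEnergy v (n c) (U c) := by
  induction T using Finset.induction_on with
  | empty => simp [infEnergy_zero]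
  | insert c T hc ih =>
    rw [Finset.sum_insert hc, Finset.sum_insert hc, Finset.set_biUnion_insert]
    have hsep' : ∀ c₁ ∈ T, ∀ c₂ ∈ T, c₁ ≠ c₂ → ∀ x ∈ U c₁, ∀ y ∈ U c₂, R < dist x y :=
      fun c₁ h₁ c₂ h₂ => hsep c₁ (Finset.mem_insert_of_mem h₁) c₂ (Finset.mem_insert_of_mem h₂)
    refine (infEnergy_union_le hv hv0 hR fun x hx y hy => ?_).trans (add_le_add le_rfl (ih hsep'))
    simp only [Set.mem_iUnion] at hy
    obtain ⟨c', hc', hy⟩ := hy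
    exact hsep c (Finset.mem_insert_self c T) c' (Finset.mem_insert_of_mem hc')
      (fun h => hc (h ▸ hc')) x hx y hy

/-- The open cube of side `s` centred at `y`. [folklore] -/
def cubeAt (y : Space) (s : ℝ) : Set Space :=
  {x | x - (y - WithLp.toLp 2 fun _ => s / 2) ∈ box s}

/-- Membership in the centred cube, coordinatewise. [folklore] -/
theorem mem_cubeAt {y x : Space} {s : ℝ} :
    x ∈ cubeAt y s ↔ ∀ k, x k - y k ∈ Set.Ioo (-(s / 2)) (s / 2) := by
  simp only [cubeAt, box, Set.mem_setOf_eq, Set.mem_Ioo]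
  refine forall_congr' fun k => ?_
  simp only [PiLp.sub_apply]
  constructor <;> rintro ⟨h1, h2⟩ <;> constructor <;> linarith

/-- Points of the centred cube are within `s` of the centre. [folklore] -/
theorem dist_lt_of_mem_cubeAt {y x : Space} {s : ℝ} (hs : 0 < s) (hx : x ∈ cubeAt y s) :
    dist x y < s := by
  rw [mem_cubeAt] at hx
  have hk : ∀ k, (x k - y k) ^ 2 < (s / 2) ^ 2 := fun k => by
    have := hx k; exact sq_lt_sq' (by linarith [this.1]) this.2
  have hsum : dist x y ^ 2 < s ^ 2 := by
    rw [dist_sq_eq_sum_coord]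
    calc ∑ k, (x k - y k) ^ 2 < ∑ _k : Fin 3, (s / 2) ^ 2 :=
          Finset.sum_lt_sum_of_nonempty Finset.univ_nonempty fun k _ => hk k
      _ = 3 * (s / 2) ^ 2 := by simp
      _ ≤ s ^ 2 := by nlinarith
  exact lt_of_pow_lt_pow_left₀ 2 hs.le hsum

/-- The centred cube has the one-particle energy of the cube of side `s`. [folklore] -/
theorem infEnergy_cubeAt_le (v : ℝ → ℝ≥0∞) (y : Space) (s : ℝ) :
    infEnergy v 1 (cubeAt y s) ≤ groundStateEnergy v 1 s := by
  rw [groundStateEnergy_eq_infEnergy]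
  exact infEnergy_translate_le v 1 (box s) _

/-- A centred cube well inside `(0, L)³` coordinatewise lies in the box `Λ_L`. [folklore] -/
theorem cubeAt_subset_box {y : Space} {s L : ℝ} (hy : ∀ k, s / 2 ≤ y k ∧ y k + s / 2 ≤ L) :
    cubeAt y s ⊆ box L := by
  intro x hx k
  rw [mem_cubeAt] at hx
  obtain ⟨h1, h2⟩ := hx k
  obtain ⟨h3, h4⟩ := hy k
  constructor <;> linarith

end Separated

/-! ### Fitting the compressed configuration into the box of the target density -/

section BoxFit

/-- Convexity of the cube: `(x + y)³ ≤ x³/w² + y³/(1-w)²` for `x, y ≥ 0`, `0 < w < 1`. [folklore] -/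
theorem add_pow_three_le {x y w : ℝ} (hx : 0 ≤ x) (hy : 0 ≤ y) (hw0 : 0 < w) (hw1 : w < 1) :
    (x + y) ^ 3 ≤ x ^ 3 / w ^ 2 + y ^ 3 / (1 - w) ^ 2 := by
  have hw1' : 0 < 1 - w := by linarith
  have h := (convexOn_pow 3).2 (Set.mem_Ici.2 (div_nonneg hx hw0.le))
    (Set.mem_Ici.2 (div_nonneg hy hw1'.le)) hw0.le hw1'.le (by ring : w + (1 - w) = 1)
  simp only [smul_eq_mul] at h
  have h1 : w * (x / w) + (1 - w) * (y / (1 - w)) = x + y := by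
    field_simp
  have h2 : w * (x / w) ^ 3 = x ^ 3 / w ^ 2 := by
    field_simp
  have h3 : (1 - w) * (y / (1 - w)) ^ 3 = y ^ 3 / (1 - w) ^ 2 := by
    field_simp
  rw [h1, h2, h3] at h
  exact h

/-- **Box fit.** If `ρ'' μ³ < (1 - ε) ρ'` then for all large `M` and every `N ≤ (M+1)/(1-ε) + C`,
the box of side `μ L_N(ρ') + 2δ` fits into the box of side `L_M(ρ'')`. [folklore] -/
theorem exists_forall_box_fit {ρ' ρ'' μ δ ε C : ℝ} (hρ' : 0 < ρ') (hρ'' : 0 < ρ'') (hμ : 0 < μ)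
    (hδ : 0 ≤ δ) (hε : 0 ≤ ε) (hε1 : ε < 1) (hC : 0 ≤ C) (hκ : ρ'' * μ ^ 3 < (1 - ε) * ρ') :
    ∃ M₀ : ℕ, ∀ M : ℕ, M₀ ≤ M → ∀ N : ℕ, (N : ℝ) ≤ (M + 1) / (1 - ε) + C →
      μ * sideLength ρ' N + 2 * δ ≤ sideLength ρ'' M := by
  have hε1' : 0 < 1 - ε := by linarith
  set κ : ℝ := ρ'' * μ ^ 3 / ((1 - ε) * ρ') with hκdef
  have hκ0 : 0 < κ := by positivity
  have hκ1 : κ < 1 := (div_lt_one (by positivity)).2 hκ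
  set w : ℝ := (1 + κ) / 2 with hw
  have hw0 : 0 < w := by positivity
  have hw1 : w < 1 := by rw [hw]; linarith
  have hκw : κ < w ^ 2 := by rw [hw]; nlinarith
  set κ₁ : ℝ := κ / w ^ 2 with hκ₁
  have hκ₁0 : 0 < κ₁ := by positivity
  have hκ₁1 : κ₁ < 1 := (div_lt_one (by positivity)).2 hκw
  set D : ℝ := (2 * δ) ^ 3 / (1 - w) ^ 2 with hD
  have hD0 : 0 ≤ D := by positivity
  obtain ⟨M₀, hM₀⟩ := exists_nat_ge ((κ₁ * (1 + C) + D * ρ'') / (1 - κ₁))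
  refine ⟨M₀, fun M hM N hN => ?_⟩
  have hM' : (κ₁ * (1 + C) + D * ρ'') / (1 - κ₁) ≤ M := hM₀.trans (by exact_mod_cast hM)
  rw [div_le_iff₀ (by linarith)] at hM'
  -- the cubes
  set x : ℝ := μ * sideLength ρ' N with hx
  have hx0 : 0 ≤ x := mul_nonneg hμ.le (sideLength_nonneg hρ'.le N)
  have hx3 : x ^ 3 = μ ^ 3 * (N / ρ') := by rw [hx, mul_pow, sideLength_pow_three hρ']
  have hLM : sideLength ρ'' M ^ 3 = M / ρ'' := sideLength_pow_three hρ'' M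
  have hconv := add_pow_three_le hx0 (by positivity : (0:ℝ) ≤ 2 * δ) hw0 hw1
  -- x³/w² ≤ κ₁ (M + 1 + C)/ρ''
  have hkey : x ^ 3 / w ^ 2 ≤ κ₁ * (M + 1 + C) / ρ'' := by
    rw [hx3, hκ₁, hκdef]
    rw [div_le_iff₀ (by positivity), div_mul_eq_mul_div, le_div_iff₀ hρ'']
    -- μ³ (N/ρ') ρ'' ≤ (ρ'' μ³/((1-ε)ρ') / w²) (M+1+C) w²  i.e. after clearing: N ≤ (M+1+C)/(1-ε)
    have hN' : (N : ℝ) ≤ (M + 1 + C) / (1 - ε) := by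
      calc (N : ℝ) ≤ (M + 1) / (1 - ε) + C := hN
        _ ≤ (M + 1) / (1 - ε) + C / (1 - ε) := by
            gcongr; exact le_div_self hC hε1' (by linarith)
        _ = (M + 1 + C) / (1 - ε) := by ring
    have : μ ^ 3 * (N / ρ') * ρ'' = (ρ'' * μ ^ 3 / ρ') * N := by ring
    rw [this]
    have h2 : ρ'' * μ ^ 3 / ((1 - ε) * ρ') / w ^ 2 * (↑M + 1 + C) * w ^ 2 =
        (ρ'' * μ ^ 3 / ρ') * ((M + 1 + C) / (1 - ε)) := by
      field_simp
    rw [h2]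
    exact mul_le_mul_of_nonneg_left hN' (by positivity)
  have hcube : (x + 2 * δ) ^ 3 ≤ sideLength ρ'' M ^ 3 := by
    rw [hLM]
    calc (x + 2 * δ) ^ 3 ≤ x ^ 3 / w ^ 2 + (2 * δ) ^ 3 / (1 - w) ^ 2 := hconv
      _ ≤ κ₁ * (M + 1 + C) / ρ'' + D := add_le_add hkey le_rfl
      _ ≤ M / ρ'' := by
          rw [div_add' _ _ _ hρ''.ne', div_le_div_iff_of_pos_right hρ'']
          nlinarith
  exact le_of_pow_le_pow_left₀ three_ne_zero (sideLength_nonneg hρ''.le M) hcube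

end BoxFit

/-! ### Hard core plus bounded tail: comparison with the pure hard-sphere gas -/

section Tail

variable {N : ℕ} {a R₀ : ℝ} {v : ℝ → ℝ≥0∞} {V : ℝ≥0∞}

/-- **Neighbour count by volume, general radius.** If all particles are pairwise at distance
`≥ a`, at most `(2r/a + 1)³` of them are within `r` of a given one. [folklore] -/
theorem card_filter_dist_lt_le_pow (ha : 0 < a) {r : ℝ} (hr : 0 < r) {X : Config N}
    (hsep : ∀ j j' : Fin N, j ≠ j' → a ≤ dist (X j) (X j')) (i : Fin N) :
    ((Finset.univ.filter fun j => j ≠ i ∧ dist (X i) (X j) < r).card : ℝ) ≤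
      (2 * r / a + 1) ^ 3 := by
  set J := Finset.univ.filter fun j => j ≠ i ∧ dist (X i) (X j) < r with hJ
  have hdisj : (J : Set (Fin N)).PairwiseDisjoint fun j => Metric.ball (X j) (a / 2) := by
    intro j _ j' _ hjj'
    exact Metric.ball_disjoint_ball (by rw [add_halves]; exact hsep j j' hjj')
  have hsub : (⋃ j ∈ J, Metric.ball (X j) (a / 2)) ⊆ Metric.ball (X i) (r + a / 2) := by
    intro x hx
    simp only [mem_iUnion] at hx
    obtain ⟨j, hj, hx⟩ := hx
    have hj' := (Finset.mem_filter.1 hj).2.2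
    rw [Metric.mem_ball] at hx ⊢
    calc dist x (X i) ≤ dist x (X j) + dist (X j) (X i) := dist_triangle _ _ _
      _ < a / 2 + r := add_lt_add hx (by rwa [dist_comm])
      _ = r + a / 2 := by ring
  have hvol := measure_mono (μ := volume) hsub
  rw [measure_biUnion_finset hdisj (fun j _ => measurableSet_ball)] at hvol
  simp only [Measure.addHaar_ball volume _ (by positivity : (0:ℝ) ≤ a / 2), Finset.sum_const,
    nsmul_eq_mul, finrank_euclideanSpace_fin] at hvol
  rw [Measure.addHaar_ball volume _ (by positivity : (0:ℝ) ≤ r + a / 2),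
    finrank_euclideanSpace_fin] at hvol
  have hV0 : volume (Metric.ball (0 : Space) 1) ≠ 0 := (Metric.measure_ball_pos volume _ one_pos).ne'
  have hVt : volume (Metric.ball (0 : Space) 1) ≠ ⊤ := measure_ball_lt_top.ne
  rw [← mul_assoc] at hvol
  have h1 : (J.card : ℝ≥0∞) * ENNReal.ofReal ((a / 2) ^ 3) ≤ ENNReal.ofReal ((r + a / 2) ^ 3) :=
    (ENNReal.mul_le_mul_iff_left hV0 hVt).1 hvol
  have h2 : ((J.card : ℝ≥0∞) * ENNReal.ofReal ((a / 2) ^ 3)).toReal ≤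
      (ENNReal.ofReal ((r + a / 2) ^ 3)).toReal :=
    ENNReal.toReal_mono ENNReal.ofReal_ne_top h1
  rw [ENNReal.toReal_mul, ENNReal.toReal_natCast, ENNReal.toReal_ofReal (by positivity),
    ENNReal.toReal_ofReal (by positivity)] at h2
  have h3 : (r + a / 2) ^ 3 = (2 * r / a + 1) ^ 3 * (a / 2) ^ 3 := by
    rw [← mul_pow]; congr 1; field_simp
  rw [h3] at h2
  exact le_of_mul_le_mul_right h2 (by positivity)

/-- With all particles pairwise `> a` apart, a tail bounded by `V` on `[a, ∞)` and vanishing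
beyond `R₀` contributes at most `V · N · (2(R₀+a)/a + 1)³` to the interaction. [folklore] -/
theorem interaction_le_of_tail (ha : 0 < a) (hR : 0 ≤ R₀) (htail : ∀ r, a ≤ r → v r ≤ V)
    (hrange : ∀ r, R₀ < r → v r = 0) {X : Config N}
    (hsep : ∀ i j : Fin N, i ≠ j → a < dist (X i) (X j)) :
    interaction v X ≤ V * (N * ENNReal.ofReal ((2 * (R₀ + a) / a + 1) ^ 3)) := by
  classical
  -- bound each term by `V · 1{dist ≤ R₀}`
  have hterm : ∀ i j : Fin N, i < j →
      v (dist (X i) (X j)) ≤ V * (if dist (X i) (X j) < R₀ + a then 1 else 0) := by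
    intro i j hij
    by_cases hfar : R₀ < dist (X i) (X j)
    · rw [hrange _ hfar]; exact zero_le
    · rw [if_pos (by linarith [not_lt.1 hfar]), mul_one]
      exact htail _ (hsep i j hij.ne).le
  calc interaction v X
      ≤ ∑ i : Fin N, ∑ j ∈ Finset.univ.filter (fun j => i < j),
          V * (if dist (X i) (X j) < R₀ + a then 1 else 0) :=
        Finset.sum_le_sum fun i _ => Finset.sum_le_sum fun j hj =>
          hterm i j (Finset.mem_filter.1 hj).2
    _ = V * ∑ i : Fin N, (((Finset.univ.filter fun j => i < j).filter
          fun j => dist (X i) (X j) < R₀ + a).card : ℝ≥0∞) := by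
        rw [Finset.mul_sum]
        refine Finset.sum_congr rfl fun i _ => ?_
        rw [← Finset.mul_sum, Finset.sum_ite, Finset.sum_const_zero, add_zero, Finset.sum_const,
          nsmul_eq_mul, mul_one]
    _ ≤ V * ∑ _i : Fin N, ENNReal.ofReal ((2 * (R₀ + a) / a + 1) ^ 3) := by
        refine mul_le_mul' le_rfl (Finset.sum_le_sum fun i _ => ?_)
        have hsub : ((Finset.univ.filter fun j => i < j).filter
            fun j => dist (X i) (X j) < R₀ + a) ⊆
            Finset.univ.filter fun j => j ≠ i ∧ dist (X i) (X j) < R₀ + a := by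
          intro j hj
          simp only [Finset.mem_filter, Finset.mem_univ, true_and] at hj ⊢
          exact ⟨hj.1.ne', hj.2⟩
        have hc := card_filter_dist_lt_le_pow ha (by linarith : 0 < R₀ + a)
          (fun j j' hjj' => (hsep j j' hjj').le) i
        calc (((Finset.univ.filter fun j => i < j).filter
              fun j => dist (X i) (X j) < R₀ + a).card : ℝ≥0∞)
            ≤ ((Finset.univ.filter fun j => j ≠ i ∧ dist (X i) (X j) < R₀ + a).card : ℝ≥0∞) := by
              exact_mod_cast Finset.card_le_card hsub
          _ = ENNReal.ofReal ((Finset.univ.filter fun j => j ≠ i ∧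
                dist (X i) (X j) < R₀ + a).card : ℝ) := by rw [ENNReal.ofReal_natCast]
          _ ≤ ENNReal.ofReal ((2 * (R₀ + a) / a + 1) ^ 3) := ENNReal.ofReal_le_ofReal hc
    _ = V * (N * ENNReal.ofReal ((2 * (R₀ + a) / a + 1) ^ 3)) := by
        rw [Finset.sum_const, Finset.card_univ, Fintype.card_fin, nsmul_eq_mul]

/-- **Comparison with the pure hard-sphere gas.** For a potential with hard core of diameter `a`,
tail bounded by `V` on `[a, ∞)` and range `R₀`, the energy of a `C¹` wave function exceeds its
hard-sphere energy by at most `V N (2(R₀+a)/a + 1)³ ∫|ψ|²` (where the hard-sphere energy is finite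
the wave function vanishes unless all particles are `> a` apart, and then each particle has at
most `(2(R₀+a)/a + 1)³` partners within range). [folklore] -/
theorem rawEnergy_le_rawEnergy_hardCorePotential_add (ha : 0 < a) (hR : 0 ≤ R₀)
    (htail : ∀ r, a ≤ r → v r ≤ V) (hrange : ∀ r, R₀ < r → v r = 0)
    {ψ : Config N → ℂ} (hψ : ContDiff ℝ 1 ψ)
    (hfin : rawEnergy (hardCorePotential a) ψ ≠ ⊤) :
    rawEnergy v ψ ≤ rawEnergy (hardCorePotential a) ψ +
      V * (N * ENNReal.ofReal ((2 * (R₀ + a) / a + 1) ^ 3)) * ∫⁻ X, (‖ψ X‖₊ : ℝ≥0∞) ^ 2 := by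
  set C : ℝ≥0∞ := V * (N * ENNReal.ofReal ((2 * (R₀ + a) / a + 1) ^ 3)) with hC
  have hpt : ∀ X, kineticDensity ψ X + interaction v X * (‖ψ X‖₊ : ℝ≥0∞) ^ 2 ≤
      (kineticDensity ψ X + interaction (hardCorePotential a) X * (‖ψ X‖₊ : ℝ≥0∞) ^ 2) +
        C * (‖ψ X‖₊ : ℝ≥0∞) ^ 2 := by
    intro X
    by_cases hX : ψ X = 0
    · simp [hX]
    · have hsep : ∀ i j : Fin N, i ≠ j → a < dist (X i) (X j) := by
        intro i j hij
        by_contra h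
        exact hX (eq_zero_of_dist_le ha (fun r hr => hardCorePotential_of_lt hr) hψ.continuous
          hfin X i j hij (not_lt.1 h))
      have h1 : interaction v X ≤ C := interaction_le_of_tail ha hR htail hrange hsep
      calc kineticDensity ψ X + interaction v X * (‖ψ X‖₊ : ℝ≥0∞) ^ 2
          ≤ kineticDensity ψ X + C * (‖ψ X‖₊ : ℝ≥0∞) ^ 2 :=
            add_le_add le_rfl (mul_le_mul' h1 le_rfl)
        _ ≤ _ := by
            rw [add_assoc]
            exact add_le_add le_rfl le_add_self
  calc rawEnergy v ψ ≤ ∫⁻ X, (kineticDensity ψ X +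
        interaction (hardCorePotential a) X * (‖ψ X‖₊ : ℝ≥0∞) ^ 2) + C * (‖ψ X‖₊ : ℝ≥0∞) ^ 2 :=
        lintegral_mono hpt
    _ = rawEnergy (hardCorePotential a) ψ + C * ∫⁻ X, (‖ψ X‖₊ : ℝ≥0∞) ^ 2 := by
        rw [lintegral_add_left (measurable_energyDensity (measurable_hardCorePotential a)
          hψ.continuous), lintegral_const_mul _ (measurable_ennnormSq hψ.continuous)]
        rfl

/-- The same comparison for the confined ground-state energies:
`E_v(N, U) ≤ E_{hard core}(N, U) + V N (2(R₀+a)/a + 1)³`. [folklore] -/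
theorem infEnergy_le_infEnergy_hardCorePotential_add (ha : 0 < a) (hR : 0 ≤ R₀)
    (htail : ∀ r, a ≤ r → v r ≤ V) (hrange : ∀ r, R₀ < r → v r = 0)
    (N : ℕ) (U : Set Space) :
    infEnergy v N U ≤ infEnergy (hardCorePotential a) N U +
      V * (N * ENNReal.ofReal ((2 * (R₀ + a) / a + 1) ^ 3)) := by
  rw [infEnergy, infEnergy, ENNReal.iInf_add]
  refine le_iInf fun Ψ => iInf_le_of_le Ψ ?_
  by_cases hfin : rawEnergy (hardCorePotential a) Ψ.ψ = ⊤
  · rw [hfin, top_add]; exact le_top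
  · have h := rawEnergy_le_rawEnergy_hardCorePotential_add ha hR htail hrange Ψ.contDiff hfin
    rwa [Ψ.norm_eq, mul_one] at h

end Tail

/-! ### The compression lemma -/

section Compression

variable {a R₀ : ℝ} {v : ℝ → ℝ≥0∞} {V : ℝ≥0∞}

/-- **The compression lemma (free-volume argument).** Let `v` have a hard core of diameter `a`
(`v = +∞` on `r < a`), a tail bounded by `V < ∞` on `[a, ∞)` and range `R₀`. If along the cube
sequence of density `ρ'` the Dirichlet energies satisfy `E₀^D(N, L_N(ρ')) ≤ G N` for all large `N`
(`G < ∞`), then for `0 < δ ≤ a/20` with `2304 a (G+1) δ ≤ 1` the upper energy per particle is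
finite at the strictly larger density `ρ'(1 + δ/(4a))`: a near-minimiser does not vanish at a
configuration with at most `576 δ² (G+1) N + 1` tight particles
(`exists_ne_zero_tightPairCount_le`); discarding them leaves `M ≥ (1 - ε)N - 1` particles
pairwise `≥ a + δ` apart, which after scaling by `(a + δ/2)/(a + δ)` carry disjoint cubes of side
`δ/8` pairwise more than `a` apart inside a box of the larger density, so
`E₀^D(M, L_M) ≤ M (E₀^{D,hard core}(1, δ/8) + V (2(R₀+a)/a + 1)³)` by subadditivity of the
hard-sphere energy over separated regions and the tail comparison. [folklore] -/
theorem limsupEnergyPerParticle_lt_top_of_compression (ha : 0 < a) (hR : 0 ≤ R₀)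
    (hcore : ∀ r, r < a → v r = ⊤) (hV : V ≠ ⊤)
    (htail : ∀ r, a ≤ r → v r ≤ V) (hrange : ∀ r, R₀ < r → v r = 0)
    {δ : ℝ} (hδ : 0 < δ) (hδa : 20 * δ ≤ a) {ρ' : ℝ} (hρ' : 0 < ρ') {G : ℝ≥0∞} (hG : G ≠ ⊤)
    (hδG : 2304 * a * (G.toReal + 1) * δ ≤ 1)
    (hbound : ∀ᶠ N : ℕ in atTop, groundStateEnergy v N (sideLength ρ' N) ≤ G * N) :
    limsupEnergyPerParticle v (ρ' * (1 + δ / (4 * a))) < ⊤ := by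
  obtain ⟨N₀, hN₀⟩ := eventually_atTop.1 hbound
  -- constants
  set g : ℝ := G.toReal with hg
  have hg0 : 0 ≤ g := ENNReal.toReal_nonneg
  have hG' : G = ENNReal.ofReal g := (ENNReal.ofReal_toReal hG).symm
  set ε : ℝ := 576 * δ ^ 2 * (g + 1) with hε
  have hε0 : 0 ≤ ε := by positivity
  have hεδ : ε ≤ δ / (4 * a) := by
    rw [hε, le_div_iff₀ (by positivity)]
    nlinarith [mul_pos hδ (by positivity : (0:ℝ) < a * (g + 1))]
  have hδa' : δ / (4 * a) ≤ 1 / 80 := by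
    rw [div_le_div_iff₀ (by positivity) (by norm_num)]; linarith
  have hε1 : ε ≤ 1 / 80 := hεδ.trans hδa'
  set μ : ℝ := (a + δ / 2) / (a + δ) with hμ
  have hμ0 : 0 < μ := by positivity
  have hμa : μ * (a + δ) = a + δ / 2 := by rw [hμ]; field_simp
  set s : ℝ := δ / 8 with hs
  have hs0 : 0 < s := by positivity
  set Kt : ℝ≥0∞ := V * ENNReal.ofReal ((2 * (R₀ + a) / a + 1) ^ 3) with hKt
  have hKttop : Kt < ⊤ := ENNReal.mul_lt_top hV.lt_top ENNReal.ofReal_lt_top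
  set e₁ : ℝ≥0∞ := groundStateEnergy (hardCorePotential a) 1 s + Kt with he₁
  have he₁top : e₁ < ⊤ := ENNReal.add_lt_top.2 ⟨groundStateEnergy_one_lt_top _ hs0, hKttop⟩
  set ρ'' : ℝ := ρ' * (1 + δ / (4 * a)) with hρ''
  have hρ''0 : 0 < ρ'' := by positivity
  -- the strict density inequality `ρ'' μ³ < (1 - ε) ρ'`
  have hκ : ρ'' * μ ^ 3 < (1 - ε) * ρ' := by
    have hpoly : (4 * a + δ) * (a + δ / 2) ^ 3 < (4 * a - δ) * (a + δ) ^ 3 := by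
      have hexp : (4 * a - δ) * (a + δ) ^ 3 - (4 * a + δ) * (a + δ / 2) ^ 3 =
          δ * (4 * a ^ 3 + 9 / 2 * a ^ 2 * δ - 1 / 4 * a * δ ^ 2 - 9 / 8 * δ ^ 3) := by ring
      have hpos : 0 < 4 * a ^ 3 + 9 / 2 * a ^ 2 * δ - 1 / 4 * a * δ ^ 2 - 9 / 8 * δ ^ 3 := by
        have hδa1 : δ ≤ a := by linarith
        nlinarith [mul_pos ha hδ, pow_pos ha 3, mul_pos (pow_pos ha 2) hδ,
          mul_le_mul_of_nonneg_left hδa1 (by positivity : (0:ℝ) ≤ a * δ),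
          mul_le_mul_of_nonneg_left hδa1 (by positivity : (0:ℝ) ≤ δ ^ 2)]
      nlinarith [mul_pos hδ hpos]
    have h1 : ρ'' * μ ^ 3 = ρ' * ((4 * a + δ) * (a + δ / 2) ^ 3 / (4 * a * (a + δ) ^ 3)) := by
      rw [hρ'', hμ]; field_simp
    have h2 : (1 - δ / (4 * a)) * ρ' = ρ' * ((4 * a - δ) * (a + δ) ^ 3 / (4 * a * (a + δ) ^ 3)) := by
      field_simp
    have h3 : ρ'' * μ ^ 3 < (1 - δ / (4 * a)) * ρ' := by
      rw [h1, h2]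
      refine mul_lt_mul_of_pos_left ?_ hρ'
      exact div_lt_div_of_pos_right hpoly (by positivity)
    have h4 : (1 - δ / (4 * a)) * ρ' ≤ (1 - ε) * ρ' :=
      mul_le_mul_of_nonneg_right (by linarith) hρ'.le
    exact h3.trans_le h4
  -- box fit
  obtain ⟨M₀, hfit⟩ := exists_forall_box_fit hρ' hρ''0 hμ0 hδ.le hε0 (by linarith)
    (by positivity : (0:ℝ) ≤ N₀ + 2) hκ
  -- the main claim: for large `M`, `E₀^D(M, L_M(ρ''))/M ≤ e₁`
  have hclaim : ∀ M : ℕ, max M₀ 1 ≤ M → energyPerParticleDirichlet v ρ'' M ≤ e₁ := by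
    intro M hM
    have hMM₀ : M₀ ≤ M := (le_max_left _ _).trans hM
    have hM1 : 1 ≤ M := (le_max_right _ _).trans hM
    have hM0 : (M : ℝ≥0∞) ≠ 0 := Nat.cast_ne_zero.2 (by omega)
    -- the particle number `N` of the state we compress
    set N : ℕ := ⌈((M : ℝ) + 1) / (1 - ε)⌉₊ + N₀ + 1 with hN
    have hNN₀ : N₀ ≤ N := by omega
    have hN1 : 0 < N := by omega
    have hNge : ((M : ℝ) + 1) / (1 - ε) ≤ N := by
      refine (Nat.le_ceil _).trans ?_
      rw [hN]; push_cast; linarith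
    have hNle : (N : ℝ) ≤ ((M : ℝ) + 1) / (1 - ε) + (N₀ + 2) := by
      have := Nat.ceil_lt_add_one (div_nonneg (by positivity) (by linarith) :
        (0:ℝ) ≤ ((M : ℝ) + 1) / (1 - ε))
      rw [hN]; push_cast; linarith
    set L : ℝ := sideLength ρ' N with hL
    -- a trial state with energy `< (G+1) N`
    have hgs : groundStateEnergy v N L < (G + 1) * N :=
      (hN₀ N hNN₀).trans_lt ((ENNReal.mul_lt_mul_iff_left (Nat.cast_ne_zero.2 hN1.ne')
        (ENNReal.natCast_ne_top N)).2 (ENNReal.lt_add_right hG one_ne_zero))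
    rw [groundStateEnergy] at hgs
    obtain ⟨Ψ, hΨ⟩ := iInf_lt_iff.1 hgs
    have hEtop : rawEnergy v Ψ.ψ ≠ ⊤ := (lt_of_lt_of_le hΨ le_top).ne
    have hKE : ∫⁻ X, kineticDensity Ψ.ψ X ≤ (G + 1) * N :=
      (lintegral_mono fun X => le_self_add).trans hΨ.le
    -- the Markov step
    obtain ⟨X₀, hX₀ne, hX₀count⟩ :=
      exists_ne_zero_tightPairCount_le ha hδ hδa hcore Ψ.contDiff hEtop Ψ.norm_eq
    have hX₀box : X₀ ∈ boxN N L := by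
      by_contra h; exact hX₀ne (Ψ.eq_zero X₀ h)
    have hX₀sep : ∀ i j : Fin N, i ≠ j → a < dist (X₀ i) (X₀ j) := by
      intro i j hij
      by_contra h
      exact hX₀ne (eq_zero_of_dist_le ha hcore Ψ.contDiff.continuous hEtop X₀ i j hij (not_lt.1 h))
    -- the tight set is small
    set T := tightSet a δ X₀ with hT
    have hTcard : ((T.card : ℕ) : ℝ) ≤ ε * N + 1 := by
      have h1 : ((T.card : ℕ) : ℝ≥0∞) ≤ ENNReal.ofReal (576 * δ ^ 2) * ((G + 1) * N) + 1 :=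
        (card_tightSet_le a δ X₀).trans (hX₀count.trans
          (add_le_add (mul_le_mul' le_rfl hKE) le_rfl))
      have h2 : ENNReal.ofReal (576 * δ ^ 2) * ((G + 1) * N) + 1 = ENNReal.ofReal (ε * N + 1) := by
        rw [hG', ← ENNReal.ofReal_one, ← ENNReal.ofReal_add hg0 zero_le_one,
          ← ENNReal.ofReal_natCast N, ← ENNReal.ofReal_mul (by positivity),
          ← ENNReal.ofReal_mul (by positivity), ← ENNReal.ofReal_add (by positivity) zero_le_one]
        congr 1
        rw [hε]; ring
      rw [h2] at h1
      have h3 := ENNReal.toReal_mono ENNReal.ofReal_ne_top h1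
      rwa [ENNReal.toReal_ofReal (by positivity), ENNReal.toReal_natCast] at h3
    -- the good set has at least `M` particles
    set Gd : Finset (Fin N) := Tᶜ with hGd
    have hGdcard : M ≤ Gd.card := by
      have hTle : T.card ≤ N := by simpa using T.card_le_univ
      have h1 : (Gd.card : ℝ) = N - T.card := by
        rw [hGd, Finset.card_compl, Fintype.card_fin, Nat.cast_sub hTle]
      have h2 : ((M : ℝ) + 1) ≤ (1 - ε) * N := by
        rwa [div_le_iff₀' (by linarith)] at hNge
      have h3 : (M : ℝ) ≤ Gd.card := by rw [h1]; nlinarith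
      exact_mod_cast h3
    obtain ⟨S, hSG, hScard⟩ := Finset.exists_subset_card_eq hGdcard
    -- index the chosen good particles by `Fin M`
    have hcardS : Fintype.card S = M := by simp [hScard]
    let eS : Fin M ≃ S := (Fintype.equivFinOfCardEq hcardS).symm
    let idx : Fin M → Fin N := fun m => (eS m : Fin N)
    have hidx_mem : ∀ m, idx m ∈ S := fun m => (eS m).2
    have hidx_inj : Function.Injective idx := fun m m' h => eS.injective (Subtype.ext h)
    have hgood : ∀ m, idx m ∉ T := fun m => Finset.mem_compl.1 (hSG (hidx_mem m))
    -- centres and cubes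
    let c : Space := WithLp.toLp 2 fun _ => δ
    let y : Fin M → Space := fun m => μ • X₀ (idx m) + c
    have hydist : ∀ m m', m ≠ m' → a + δ / 2 ≤ dist (y m) (y m') := by
      intro m m' hmm'
      have hne : idx m' ≠ idx m := fun h => hmm' (hidx_inj h).symm
      have h1 : a + δ ≤ dist (X₀ (idx m)) (X₀ (idx m')) :=
        le_dist_of_not_mem_tightSet (hgood m) hne (hX₀sep _ _ hne.symm)
      have h2 : dist (y m) (y m') = μ * dist (X₀ (idx m)) (X₀ (idx m')) := by
        simp only [y, dist_add_right, dist_smul₀, Real.norm_eq_abs, abs_of_pos hμ0]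
      rw [h2, ← hμa]
      exact mul_le_mul_of_nonneg_left h1 hμ0.le
    have hsepU : ∀ m ∈ (Finset.univ : Finset (Fin M)), ∀ m' ∈ (Finset.univ : Finset (Fin M)),
        m ≠ m' → ∀ x ∈ cubeAt (y m) s, ∀ x' ∈ cubeAt (y m') s, a < dist x x' := by
      intro m _ m' _ hmm' x hx x' hx'
      have h1 := hydist m m' hmm'
      have h2 := dist_lt_of_mem_cubeAt hs0 hx
      have h3 := dist_lt_of_mem_cubeAt hs0 hx'
      have h4 : dist (y m) (y m') ≤ dist (y m) x + dist x x' + dist x' (y m') :=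
        dist_triangle4 _ _ _ _
      rw [dist_comm (y m) x] at h4
      have hs8 : s = δ / 8 := rfl
      linarith
    have hUbox : ∀ m, cubeAt (y m) s ⊆ box (μ * L + 2 * δ) := by
      intro m
      refine cubeAt_subset_box fun k => ?_
      have hk : X₀ (idx m) k ∈ Set.Ioo 0 L := hX₀box (idx m) k
      have hyk : y m k = μ * X₀ (idx m) k + δ := by simp [y, c]
      rw [hyk]
      have hs8 : s = δ / 8 := rfl
      constructor
      · have : 0 ≤ μ * X₀ (idx m) k := mul_nonneg hμ0.le hk.1.le
        linarith
      · have : μ * X₀ (idx m) k ≤ μ * L := mul_le_mul_of_nonneg_left hk.2.le hμ0.le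
        linarith
    -- energy of `M` particles in the box of side `μ L + 2δ`
    have hEM : groundStateEnergy v M (μ * L + 2 * δ) ≤ M * e₁ := by
      rw [groundStateEnergy_eq_infEnergy]
      have hhc0 : ∀ r, a < r → hardCorePotential a r = 0 := fun r hr =>
        hardCorePotential_of_le hr.le
      calc infEnergy v M (box (μ * L + 2 * δ))
          ≤ infEnergy v M (⋃ m ∈ (Finset.univ : Finset (Fin M)), cubeAt (y m) s) :=
            infEnergy_anti (Set.iUnion₂_subset fun m _ => hUbox m)
        _ ≤ infEnergy (hardCorePotential a) M
              (⋃ m ∈ (Finset.univ : Finset (Fin M)), cubeAt (y m) s) + M * Kt := by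
            have h := infEnergy_le_infEnergy_hardCorePotential_add ha hR htail hrange M
              (⋃ m ∈ (Finset.univ : Finset (Fin M)), cubeAt (y m) s)
            refine h.trans (le_of_eq ?_)
            rw [hKt]; ring
        _ = infEnergy (hardCorePotential a) (∑ _m ∈ (Finset.univ : Finset (Fin M)), 1)
              (⋃ m ∈ (Finset.univ : Finset (Fin M)), cubeAt (y m) s) + M * Kt := by simp
        _ ≤ (∑ m ∈ (Finset.univ : Finset (Fin M)),
              infEnergy (hardCorePotential a) 1 (cubeAt (y m) s)) + M * Kt :=
            add_le_add (infEnergy_biUnion_le_of_separated (measurable_hardCorePotential a) hhc0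
              ha.le Finset.univ (fun m => cubeAt (y m) s) hsepU (fun _ => 1)) le_rfl
        _ ≤ (∑ _m ∈ (Finset.univ : Finset (Fin M)),
              groundStateEnergy (hardCorePotential a) 1 s) + M * Kt :=
            add_le_add (Finset.sum_le_sum fun m _ => infEnergy_cubeAt_le _ (y m) s) le_rfl
        _ = M * e₁ := by simp [he₁, mul_add]
    -- the box fits, hence the bound at density `ρ''`
    have hfitM : μ * L + 2 * δ ≤ sideLength ρ'' M := hfit M hMM₀ N hNle
    calc energyPerParticleDirichlet v ρ'' M
        = groundStateEnergy v M (sideLength ρ'' M) / M := rfl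
      _ ≤ groundStateEnergy v M (μ * L + 2 * δ) / M :=
          ENNReal.div_le_div_right (groundStateEnergy_anti v M hfitM) _
      _ ≤ M * e₁ / M := ENNReal.div_le_div_right hEM _
      _ = e₁ := by rw [mul_comm]; exact ENNReal.mul_div_cancel_right hM0 (ENNReal.natCast_ne_top M)
  -- conclusion
  refine lt_of_le_of_lt ?_ he₁top
  exact Filter.limsup_le_of_le (h := (eventually_atTop.2 ⟨max M₀ 1, hclaim⟩))

end Compression

/-! ### Blow-up at the critical density and boundary-condition independence for hard cores -/

section CriticalDensity

variable {a R₀ : ℝ} {v w : ℝ → ℝ≥0∞} {V : ℝ≥0∞}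

/-- The Dirichlet ground-state energy is monotone in the potential. [folklore] -/
theorem groundStateEnergy_mono_potential (h : ∀ r, v r ≤ w r) (N : ℕ) (L : ℝ) :
    groundStateEnergy v N L ≤ groundStateEnergy w N L :=
  iInf_mono fun _ => lintegral_mono fun _ => add_le_add le_rfl
    (mul_le_mul' (Finset.sum_le_sum fun _ _ => Finset.sum_le_sum fun _ _ => h _) le_rfl)

/-- The upper energy per particle is monotone in the potential. [folklore] -/
theorem limsupEnergyPerParticle_mono_potential (h : ∀ r, v r ≤ w r) (ρ : ℝ) :
    limsupEnergyPerParticle v ρ ≤ limsupEnergyPerParticle w ρ :=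
  limsup_le_limsup (Eventually.of_forall fun N =>
    ENNReal.div_le_div_right (groundStateEnergy_mono_potential h _ _) _)

/-- The critical density is antitone in the potential. [folklore] -/
theorem criticalDensity_anti_potential (h : ∀ r, v r ≤ w r) :
    criticalDensity w ≤ criticalDensity v :=
  iSup₂_le fun ρ hρ => le_iSup₂ (f := fun ρ (_ : 0 < ρ ∧ limsupEnergyPerParticle v ρ < ⊤) =>
    ENNReal.ofReal ρ) ρ ⟨hρ.1, (limsupEnergyPerParticle_mono_potential h ρ).trans_lt hρ.2⟩

/-- A potential with a hard core of diameter `a > 0` has a finite critical density (comparison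
with the pure hard-sphere gas, `criticalDensity_hardCorePotential_lt_top`).
[cite: Ruelle1969, §3.3.12] -/
theorem criticalDensity_lt_top_of_hardCore (ha : 0 < a) (hcore : ∀ r, r < a → v r = ⊤) :
    criticalDensity v < ⊤ := by
  refine lt_of_le_of_lt (criticalDensity_anti_potential (v := hardCorePotential a) fun r => ?_)
    (criticalDensity_hardCorePotential_lt_top ha)
  by_cases hr : r < a
  · rw [hcore r hr]; exact le_top
  · rw [hardCorePotential_of_le (not_lt.1 hr)]; exact zero_le

/-- **Blow-up of the energy per particle at the critical density of a hard-core Bose gas.**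
For a potential with a hard core of diameter `a` (`v = +∞` on `r < a`), a tail bounded by `V < ∞`
on `[a, ∞)` and finite range, and any `ρ ≥ ρ_c(v)`, the left envelope `sup_{0<ρ'<ρ} e⁺(ρ')` of
the Dirichlet energy per particle is `+∞`: the energy per particle is unbounded on approach to the
close-packing density. Otherwise the compression lemma would produce a finite upper energy per
particle strictly above `ρ_c(v)`. (Free-volume picture of the jammed hard-sphere gas; for this
sequence and these carriers we know of no printed proof and tag the statement folklore.)
[folklore] -/
theorem iSup_limsupEnergyPerParticle_eq_top_of_hardCore (ha : 0 < a) (hR : 0 ≤ R₀)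
    (hv : Measurable v) (hcore : ∀ r, r < a → v r = ⊤) (hV : V ≠ ⊤)
    (htail : ∀ r, a ≤ r → v r ≤ V) (hrange : ∀ r, R₀ < r → v r = 0) {ρ : ℝ}
    (hρc : criticalDensity v ≤ ENNReal.ofReal ρ) :
    (⨆ (ρ' : ℝ) (_ : 0 < ρ' ∧ ρ' < ρ), limsupEnergyPerParticle v ρ') = ⊤ := by
  by_contra hne
  set Gm := ⨆ (ρ' : ℝ) (_ : 0 < ρ' ∧ ρ' < ρ), limsupEnergyPerParticle v ρ' with hGm
  have hvR : IsRepulsiveFiniteRange v := ⟨hv, R₀, hrange⟩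
  have hρpos : 0 < ρ := by
    have h := (criticalDensity_pos hvR).trans_le hρc
    simpa using h
  set G : ℝ≥0∞ := Gm + 1 with hGdef
  have hG : G ≠ ⊤ := by simpa [hGdef] using hne
  set g : ℝ := G.toReal with hg
  have hg0 : 0 ≤ g := ENNReal.toReal_nonneg
  set δ : ℝ := min (a / 20) (1 / (2304 * a * (g + 1))) with hδ
  have hδ0 : 0 < δ := lt_min (by positivity) (by positivity)
  have hδa : 20 * δ ≤ a := by
    have := min_le_left (a / 20) (1 / (2304 * a * (g + 1))); linarith
  have hδG : 2304 * a * (g + 1) * δ ≤ 1 := by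
    have h := min_le_right (a / 20) (1 / (2304 * a * (g + 1)))
    rw [le_div_iff₀ (by positivity)] at h
    linarith
  set ρ' : ℝ := ρ / (1 + δ / (8 * a)) with hρ'
  have hρ'0 : 0 < ρ' := by positivity
  have hρ'lt : ρ' < ρ := div_lt_self hρpos (by
    have : 0 < δ / (8 * a) := by positivity
    linarith)
  -- `e⁺(ρ') ≤ Gm < G`, hence `E₀^D(N, L_N(ρ')) ≤ G N` eventually
  have hlim : limsupEnergyPerParticle v ρ' < G :=
    (le_iSup₂ (f := fun ρ' (_ : 0 < ρ' ∧ ρ' < ρ) => limsupEnergyPerParticle v ρ') ρ'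
      ⟨hρ'0, hρ'lt⟩).trans_lt (ENNReal.lt_add_right hne one_ne_zero)
  have hbound : ∀ᶠ N : ℕ in atTop, groundStateEnergy v N (sideLength ρ' N) ≤ G * N := by
    have hev : ∀ᶠ N : ℕ in atTop, energyPerParticleDirichlet v ρ' N < G :=
      Filter.eventually_lt_of_limsup_lt hlim
    filter_upwards [hev, eventually_gt_atTop 0] with N hN hN0
    rw [energyPerParticleDirichlet, ENNReal.div_lt_iff (Or.inl (Nat.cast_ne_zero.2 hN0.ne'))
      (Or.inl (ENNReal.natCast_ne_top N))] at hN
    exact hN.le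
  have hfin := limsupEnergyPerParticle_lt_top_of_compression ha hR hcore hV htail hrange hδ0
    hδa hρ'0 hG hδG hbound
  -- but `ρ'(1 + δ/(4a)) > ρ ≥ ρ_c(v)`
  have hgt : ρ < ρ' * (1 + δ / (4 * a)) := by
    rw [hρ', div_mul_eq_mul_div, lt_div_iff₀ (by positivity)]
    have : δ / (8 * a) < δ / (4 * a) := by
      rw [div_lt_div_iff₀ (by positivity) (by positivity)]; nlinarith
    nlinarith
  have hle : ENNReal.ofReal (ρ' * (1 + δ / (4 * a))) ≤ criticalDensity v :=
    le_iSup₂ (f := fun ρ (_ : 0 < ρ ∧ limsupEnergyPerParticle v ρ < ⊤) => ENNReal.ofReal ρ) _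
      ⟨by positivity, hfin⟩
  have h := hle.trans hρc
  rw [ENNReal.ofReal_le_ofReal_iff hρpos.le] at h
  linarith

/-- **At and above the critical density of a hard-core gas the Dirichlet energies per particle
tend to `+∞`.** [folklore] -/
theorem tendsto_energyPerParticleDirichlet_top_of_hardCore (ha : 0 < a) (hR : 0 ≤ R₀)
    (hv : Measurable v) (hcore : ∀ r, r < a → v r = ⊤) (hV : V ≠ ⊤)
    (htail : ∀ r, a ≤ r → v r ≤ V) (hrange : ∀ r, R₀ < r → v r = 0) {ρ : ℝ}
    (hρc : criticalDensity v ≤ ENNReal.ofReal ρ) :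
    Tendsto (energyPerParticleDirichlet v ρ) atTop (𝓝 ⊤) :=
  tendsto_energyPerParticleDirichlet_top_of_iSup_limsup_eq_top ⟨hv, R₀, hrange⟩
    (iSup_limsupEnergyPerParticle_eq_top_of_hardCore ha hR hv hcore hV htail hrange hρc)

/-- … and so do the periodic ones. [folklore] -/
theorem tendsto_energyPerParticlePeriodic_top_of_hardCore (ha : 0 < a) (hR : 0 ≤ R₀)
    (hv : Measurable v) (hcore : ∀ r, r < a → v r = ⊤) (hV : V ≠ ⊤)
    (htail : ∀ r, a ≤ r → v r ≤ V) (hrange : ∀ r, R₀ < r → v r = 0) {ρ : ℝ}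
    (hρc : criticalDensity v ≤ ENNReal.ofReal ρ) :
    Tendsto (energyPerParticlePeriodic v ρ) atTop (𝓝 ⊤) :=
  tendsto_energyPerParticlePeriodic_top_of_iSup_limsup_eq_top ⟨hv, R₀, hrange⟩
    (iSup_limsupEnergyPerParticle_eq_top_of_hardCore ha hR hv hcore hV htail hrange hρc)

/-- **Existence of the thermodynamic limit of the energy per particle of a hard-core Bose gas at
every density** (the conclusion of `LSSY2005_e0_dirichlet_exists` for potentials with a hard core,
bounded tail and finite range, with no exceptional density): below `ρ_c` the limit is
`e⁺(ρ) < ∞` (Ruelle), at and above `ρ_c` it is `+∞`.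
[cite: LSSY2005, Ch. 2 eq. (2.2) and the paragraph following it] -/
theorem hardCore_e0_dirichlet_exists (ha : 0 < a) (hR : 0 ≤ R₀) (hv : Measurable v)
    (hcore : ∀ r, r < a → v r = ⊤) (hV : V ≠ ⊤) (htail : ∀ r, a ≤ r → v r ≤ V)
    (hrange : ∀ r, R₀ < r → v r = 0) {ρ : ℝ} (hρ : 0 < ρ) :
    ∃ e : ℝ≥0∞, Tendsto (energyPerParticleDirichlet v ρ) atTop (𝓝 e) := by
  by_cases hlt : ENNReal.ofReal ρ < criticalDensity v
  · exact ⟨_, tendsto_energyPerParticleDirichlet_of_lt_criticalDensity ⟨hv, R₀, hrange⟩ hρ hlt⟩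
  · exact ⟨⊤, tendsto_energyPerParticleDirichlet_top_of_hardCore ha hR hv hcore hV htail hrange
      (not_lt.1 hlt)⟩

/-- **Boundary-condition independence for a hard-core Bose gas at every density** (the
conclusion of `LSSY2005_e0_periodic_eq_dirichlet` for potentials with a hard core, bounded tail
and finite range, with no exceptional density): if the Dirichlet energies per particle converge to
`e` then so do the periodic ones.
[cite: LSSY2005, Ch. 2, paragraph after (2.2); Thm. 2.2 ("for all boundary conditions")] -/
theorem hardCore_e0_periodic_eq_dirichlet (ha : 0 < a) (hR : 0 ≤ R₀) (hv : Measurable v)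
    (hcore : ∀ r, r < a → v r = ⊤) (hV : V ≠ ⊤) (htail : ∀ r, a ≤ r → v r ≤ V)
    (hrange : ∀ r, R₀ < r → v r = 0) {ρ : ℝ} (hρ : 0 < ρ)
    {e : ℝ≥0∞} (he : Tendsto (energyPerParticleDirichlet v ρ) atTop (𝓝 e)) :
    Tendsto (energyPerParticlePeriodic v ρ) atTop (𝓝 e) := by
  by_cases hne : ENNReal.ofReal ρ = criticalDensity v
  · exact tendsto_energyPerParticlePeriodic_of_iSup_limsup_eq_top ⟨hv, R₀, hrange⟩
      (iSup_limsupEnergyPerParticle_eq_top_of_hardCore ha hR hv hcore hV htail hrange hne.ge) he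
  · exact LSSY2005_e0_periodic_eq_dirichlet_offCritical_holds v ⟨hv, R₀, hrange⟩ ρ hρ hne e he

/-- The hard-sphere potential `hardCorePotential a` (`+∞` on `r < a`, `0` otherwise) is in the
above class (tail `0`, range `a`), so both conclusions hold for it at every density `ρ > 0`; in
particular the restriction `LSSY2005_e0_dirichlet_exists.tendsto_hardCorePotential_at_criticalDensity`
of the vendored existence fact holds unconditionally. [cite: LSSY2005, Ch. 2, paragraph after eq. (2.1)] -/
theorem tendsto_energyPerParticle_hardCorePotential (ha : 0 < a) {ρ : ℝ} (hρ : 0 < ρ) :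
    (∃ e : ℝ≥0∞, Tendsto (energyPerParticleDirichlet (hardCorePotential a) ρ) atTop (𝓝 e)) ∧
      ∀ e : ℝ≥0∞, Tendsto (energyPerParticleDirichlet (hardCorePotential a) ρ) atTop (𝓝 e) →
        Tendsto (energyPerParticlePeriodic (hardCorePotential a) ρ) atTop (𝓝 e) :=
  have hcore : ∀ r, r < a → hardCorePotential a r = ⊤ := fun _ hr => hardCorePotential_of_lt hr
  have htail : ∀ r, a ≤ r → hardCorePotential a r ≤ (0 : ℝ≥0∞) := fun _ hr =>
    (hardCorePotential_of_le hr).le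
  have hrange : ∀ r, a < r → hardCorePotential a r = 0 := fun _ hr => hardCorePotential_of_le hr.le
  ⟨hardCore_e0_dirichlet_exists ha ha.le (measurable_hardCorePotential a) hcore ENNReal.zero_ne_top
      htail hrange hρ,
    fun _ he => hardCore_e0_periodic_eq_dirichlet ha ha.le (measurable_hardCorePotential a) hcore
      ENNReal.zero_ne_top htail hrange hρ he⟩

end CriticalDensity

end Literature.MathematicalPhysics.QuantumManyBody.BoseGas

end
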